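import Literature.NumberTheory.QuadraticFields.BakerLimitFormula
import Literature.NumberTheory.LFunctions.DirichletLOneTail
import Mathlib.NumberTheory.NumberField.Units.DirichletTheorem
import HarnessLib

/-!
# The Gelfond–Linnik–Baker inequality for a field of class number one

Topic `NumberTheory/QuadraticFields`, namespace `Literature.NumberTheory.QuadraticFields.BakerLimitFormula`.
Everything here is PROVED (theorems only, no named facts).

A. Baker, *Transcendental Number Theory* (1975), Ch. 5 §4 (pp. 50–51 of the held copy): for
`ℚ(√−d)` of class number one, the limit formula (2) with `k = 21` and `k = 33` and Dirichlet's class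
number formula `L(1, χχ') = hπ/√(kd)` give "`|h log ε − (32/21) π√d| < e^{−π√d/100}`" and
"`|h' log ε' − (80/33) π√d| < e^{−π√d/100}`", whence "`|b log ε + b' log ε'| < e^{−δB}`".
We prove the explicit forms, for an imaginary quadratic field `K` with odd discriminant
`d_K = −d < −4`, `𝓞 K` principal, `3, 7, 11 ∤ d`:

* `torsionOrder_eq_two` — `w = 2` for imaginary quadratic fields with `d_K < −4`;
* `baker_inequality_k` — for `(p, q) = (3, 7)` or `(3, 11)`:
  `|h'_{pq} · √(pq) L(1, (·/pq)) − c_{pq} π √d| ≤ 16 pq · e^{−π√d/(pq)}` with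
  `c_{21} = 64/21`, `c_{33} = 160/33` (`√21 L(1,(·/21)) = 2 log ε₂₁` by the real class number
  formula, so these are Baker's two displayed inequalities), where `h'_{k}` is the class number of
  the imaginary quadratic field of discriminant `−kd`;
* `baker_fundamental_inequality` — `|105 h'₂₁ X₂₁ − 66 h'₃₃ X₃₃| ≤ 35280 e^{−π√d/21} + 34848 e^{−π√d/33}`
  (`X_k = √k L(1, (·/k))`), together with `1 ≤ h'_k ≤ 2 (kd)²` (`classNumber_le`).

What remains for the class number one theorem along this route is a lower bound for the linear
form in the two logarithms `X₂₁ = 2 log ε₂₁`, `X₃₃ = 2 log ε₃₃` (Baker's Theorem 3.1 / Baker–Wüstholz,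
the tree's named fact `Literature.NumberTheory.DiophantineGeometry.baker_wustholz`; qualitatively
`Literature.NumberTheory.Transcendental.baker_holds`) and the finite medium range.

## References

* [Baker1975] A. Baker, *Transcendental Number Theory* (1975), Ch. 5 §4 (pp. 50–51).
-/

noncomputable section

open Filter Topology Real Complex Module NumberField NumberField.Units Ideal
open Literature.Barriers.RiemannHypothesis Literature.NumberTheory.QuadraticFields.Quadratic
open scoped NumberTheorySymbols

namespace Literature.NumberTheory.QuadraticFields.BakerLimitFormula

/-! ## `w = 2` -/

section Torsion

variable {K : Type*} [Field K] [NumberField K]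

/-- **An imaginary quadratic field with `d_K < −4` has exactly the two roots of unity `±1`**
(`torsionOrder K = 2`), by `units_eq`. [cite: Cox2013, §7.A] -/
theorem torsionOrder_eq_two (b : Basis (Fin 2) ℤ (𝓞 K)) (hb : b 0 = 1) {t m : ℤ}
    (hω : b 1 * b 1 = (m : 𝓞 K) + (t : 𝓞 K) * b 1) (hD : t ^ 2 + 4 * m < -4) :
    torsionOrder K = 2 := by
  have hall : ∀ u : (𝓞 K)ˣ, u = 1 ∨ u = -1 := fun u => by
    rcases units_eq b hb hω hD u with h | h
    · left; exact Units.ext h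
    · right; exact Units.ext h
  have htop : torsion K = ⊤ := by
    refine eq_top_iff.mpr fun u _ => ?_
    change u ∈ CommGroup.torsion (𝓞 K)ˣ
    rw [CommGroup.mem_torsion, isOfFinOrder_iff_pow_eq_one]
    refine ⟨2, two_pos, ?_⟩
    rcases hall u with rfl | rfl <;> simp
  rw [torsionOrder, htop, Subgroup.card_top, Nat.card_eq_two_iff]
  refine ⟨1, -1, ?_, ?_⟩
  · intro h
    have h1 : ((1 : (𝓞 K)ˣ) : 𝓞 K) = ((-1 : (𝓞 K)ˣ) : 𝓞 K) := congrArg Units.val h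
    simp only [Units.val_one, Units.val_neg] at h1
    have h2 : (2 : 𝓞 K) = 0 := by linear_combination h1
    exact two_ne_zero h2
  · ext u
    simp only [Set.mem_insert_iff, Set.mem_singleton_iff, Set.mem_univ, iff_true]
    exact hall u

end Torsion

/-! ## The imaginary class number formula with `w = 2`, and a bound for `h` -/

section Imaginary

variable {K : Type*} [Field K] [NumberField K]

/-- For an imaginary quadratic field with odd `d_K < −4`:
`L(1, χ_{d_K}) = π h_K / √|d_K|` (Dirichlet, with `w = 2`). [cite: Baker1975, Ch. 5 §4] -/
theorem LFunction_one_eq_pi_mul_classNumber (h2 : finrank ℚ K = 2) (hodd : Odd (NumberField.discr K))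
    (b : Basis (Fin 2) ℤ (𝓞 K)) (hb : b 0 = 1) {t m : ℤ}
    (hω : b 1 * b 1 = (m : 𝓞 K) + (t : 𝓞 K) * b 1) (hD : t ^ 2 + 4 * m < -4) :
    (jacobiChar (NumberField.discr K).natAbs).LFunction 1 =
      ((Real.pi * classNumber K / Real.sqrt ((NumberField.discr K).natAbs : ℝ) : ℝ) : ℂ) := by
  have hdisc := discr_eq_of_basis b hb hω
  have hneg : NumberField.discr K < 0 := by rw [hdisc]; linarith
  rw [LFunction_jacobiChar_one_eq_of_discr_neg h2 hodd hneg, torsionOrder_eq_two b hb hω hD]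
  congr 1
  have : |(NumberField.discr K : ℝ)| = ((NumberField.discr K).natAbs : ℝ) := by
    rw [← Int.cast_abs, Int.abs_eq_natAbs, Int.cast_natCast]
  rw [this]
  push_cast
  ring

/-- **`h_K ≤ 2 |d_K|²`** for such fields, from `|L(1, χ)| ≤ 2|d_K|` (the trivial tail bound of the
tree's `DirichletLOneTail`). [folklore] -/
theorem classNumber_le (h2 : finrank ℚ K = 2) (hodd : Odd (NumberField.discr K))
    (b : Basis (Fin 2) ℤ (𝓞 K)) (hb : b 0 = 1) {t m : ℤ}
    (hω : b 1 * b 1 = (m : 𝓞 K) + (t : 𝓞 K) * b 1) (hD : t ^ 2 + 4 * m < -4) :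
    (classNumber K : ℝ) ≤ 2 * ((NumberField.discr K).natAbs : ℝ) ^ 2 := by
  set q := (NumberField.discr K).natAbs with hq
  have hq0 : 0 < q := Int.natAbs_pos.mpr (NumberField.discr_ne_zero K)
  have hq1 : (1 : ℝ) ≤ q := by exact_mod_cast hq0
  have hL := LFunction_one_eq_pi_mul_classNumber h2 hodd b hb hω hD
  have hχ : jacobiChar q ≠ 1 := jacobiChar_natAbs_discr_ne_one h2 hodd
  have hbound := Literature.NumberTheory.LFunctions.DirichletAbel.norm_sum_div_sub_LFunction_one_le_level
    (jacobiChar q) hχ 0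
  simp only [Finset.range_zero, Finset.sum_empty, zero_sub, norm_neg, Nat.cast_zero, zero_add, div_one] at hbound
  rw [hL, Complex.norm_real, Real.norm_eq_abs,
    abs_of_nonneg (by positivity : (0 : ℝ) ≤ Real.pi * classNumber K / Real.sqrt (q : ℝ))] at hbound
  have hsqrt : Real.sqrt (q : ℝ) ≤ q := by
    rw [Real.sqrt_le_left (by positivity)]
    nlinarith
  have hpi : (3 : ℝ) < Real.pi := Real.pi_gt_three
  rw [div_le_iff₀ (Real.sqrt_pos.mpr (by positivity))] at hbound
  have hh : (0 : ℝ) ≤ (classNumber K : ℝ) := Nat.cast_nonneg _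
  nlinarith [Real.sqrt_nonneg (q : ℝ)]

end Imaginary

/-! ## Baker's inequality for one auxiliary modulus `k = pq` -/

section OneModulus

variable {K : Type*} [Field K] [NumberField K]

/-- `L(2, 𝟙_{pq})` as a real number: `(1 − p⁻²)(1 − q⁻²) π²/6`. [folklore] -/
theorem LFunction_one_two_eq_ofReal {p q : ℕ} [Fact p.Prime] [Fact q.Prime] (hpq : p ≠ q) :
    haveI : NeZero (p * q) := ⟨mul_ne_zero (Fact.out : p.Prime).ne_zero (Fact.out : q.Prime).ne_zero⟩
    (1 : DirichletCharacter ℂ (p * q)).LFunction 2 =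
      (((1 - ((p : ℝ) ^ 2)⁻¹) * (1 - ((q : ℝ) ^ 2)⁻¹) * (Real.pi ^ 2 / 6) : ℝ) : ℂ) := by
  rw [LFunction_one_two_eq hpq]
  have e : ∀ n : ℕ, (n : ℂ) ^ (-(2 : ℂ)) = (((n : ℝ) ^ 2)⁻¹ : ℝ) := fun n => by
    rw [Complex.cpow_neg, show (2 : ℂ) = ((2 : ℕ) : ℂ) by norm_num, Complex.cpow_natCast]
    push_cast; ring
  rw [e p, e q]
  push_cast
  ring

/-- The class number formula of an auxiliary imaginary quadratic field of prescribed odd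
discriminant `−N < −4`: `L(1, (·/N)) = π h'/√N` with `h'` its class number, `1 ≤ h' ≤ 2N²`.
[cite: Baker1975, Ch. 5 §4] -/
theorem exists_classNumber_LFunction_one_eq {N : ℕ} [NeZero N] (hN1 : (-(N : ℤ)) % 4 = 1)
    (hsq : Squarefree N) (hN4 : 4 < N) :
    ∃ h' : ℕ, 1 ≤ h' ∧ (h' : ℝ) ≤ 2 * (N : ℝ) ^ 2 ∧
      (jacobiChar N).LFunction 1 = ((Real.pi * h' / Real.sqrt N : ℝ) : ℂ) := by
  have hfund : ((-(N : ℤ)) % 4 = 1 ∧ Squarefree (-(N : ℤ)) ∧ (-(N : ℤ)) ≠ 1) ∨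
      (4 ∣ (-(N : ℤ)) ∧ ((-(N : ℤ)) / 4 % 4 = 2 ∨ (-(N : ℤ)) / 4 % 4 = 3) ∧ Squarefree ((-(N : ℤ)) / 4)) :=
    Or.inl ⟨hN1, by rw [← Int.squarefree_natAbs]; simpa using hsq, by omega⟩
  obtain ⟨K', _, _, h2', hd'⟩ := exists_numberField_discr_eq hfund
  obtain ⟨b', hb'⟩ := exists_basis_zero_eq_one (K := K') h2'
  set t' := b'.repr (b' 1 * b' 1) 1
  set m' := b'.repr (b' 1 * b' 1) 0
  have hω' := basis_one_mul_self_eq b' hb'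
  have hdisc' := discr_eq_sq_add_four_mul b' hb'
  have hD' : t' ^ 2 + 4 * m' < -4 := by rw [← hdisc', hd']; omega
  have hodd' : Odd (NumberField.discr K') := by rw [hd', Int.odd_iff]; omega
  have hnat : (NumberField.discr K').natAbs = N := by rw [hd']; simp
  refine ⟨classNumber K', Nat.one_le_iff_ne_zero.mpr (classNumber_ne_zero K'), ?_, ?_⟩
  · have := classNumber_le h2' hodd' b' hb' hω' hD'
    rwa [hnat] at this
  · have := LFunction_one_eq_pi_mul_classNumber h2' hodd' b' hb' hω' hD'
    subst hnat
    exact this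

/-- **Baker's inequality for the auxiliary modulus `k = pq`** (Ch. 5 §4, the displayed inequalities
for `k = 21` and `k = 33` before "`log ε`" is inserted): for `K` imaginary quadratic with odd
`d_K = t² + 4m = −d < −4`, `𝓞 K` principal, `p ≠ q` odd primes not dividing `d` with `pq ≡ 1 (mod 4)`,
and `e^{−π√d/(pq)} ≤ ½`, there is `h' ∈ [1, 2(pqd)²]` (the class number of the field of discriminant
`−pqd`) with
`|h' √(pq) L(1, (·/pq)) − (1 − p⁻²)(1 − q⁻²)(pq/6) π √d| ≤ 16 pq e^{−π√d/(pq)}`.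
[cite: Baker1975, Ch. 5 §4] -/
theorem baker_inequality_k (h2 : finrank ℚ K = 2) (hodd : Odd (NumberField.discr K))
    [IsPrincipalIdealRing (𝓞 K)] (b : Basis (Fin 2) ℤ (𝓞 K)) (hb : b 0 = 1) {t m : ℤ}
    (hω : b 1 * b 1 = (m : 𝓞 K) + (t : 𝓞 K) * b 1) (hD : t ^ 2 + 4 * m < -4)
    {p q : ℕ} [Fact p.Prime] [Fact q.Prime] (hp2 : p ≠ 2) (hq2 : q ≠ 2) (hpq : p ≠ q)
    (hk4 : p * q % 4 = 1) (hpd : ¬ (p : ℤ) ∣ t ^ 2 + 4 * m) (hqd : ¬ (q : ℤ) ∣ t ^ 2 + 4 * m)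
    (hη : Real.exp (-(Real.pi * Real.sqrt (-(t ^ 2 + 4 * m : ℤ) : ℝ) / (p * q))) ≤ 1 / 2) :
    haveI : NeZero (p * q) := ⟨mul_ne_zero (Fact.out : p.Prime).ne_zero (Fact.out : q.Prime).ne_zero⟩
    ∃ h' : ℕ, 1 ≤ h' ∧ (h' : ℝ) ≤ 2 * ((p * q : ℕ) * (-(t ^ 2 + 4 * m : ℤ) : ℝ)) ^ 2 ∧
      ‖(h' : ℂ) * (Real.sqrt (p * q : ℕ) : ℂ) * (jacobiChar (p * q)).LFunction 1 -
          (((1 - ((p : ℝ) ^ 2)⁻¹) * (1 - ((q : ℝ) ^ 2)⁻¹) * ((p * q : ℕ) / 6) * Real.pi *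
            Real.sqrt (-(t ^ 2 + 4 * m : ℤ) : ℝ) : ℝ) : ℂ)‖ ≤
        16 * (p * q : ℕ) * Real.exp (-(Real.pi * Real.sqrt (-(t ^ 2 + 4 * m : ℤ) : ℝ) / (p * q))) := by
  haveI : NeZero (p * q) := ⟨mul_ne_zero (Fact.out : p.Prime).ne_zero (Fact.out : q.Prime).ne_zero⟩
  set d : ℕ := (NumberField.discr K).natAbs with hd
  have hdisc := discr_eq_of_basis b hb hω
  have hdZ : (d : ℤ) = -(t ^ 2 + 4 * m) := by
    rw [hd, ← hdisc]; have := NumberField.discr_ne_zero K; omega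
  have hdR : ((-(t ^ 2 + 4 * m : ℤ)) : ℝ) = (d : ℝ) := by exact_mod_cast hdZ.symm
  have hd4 : 4 < d := by zify; rw [hdZ]; linarith
  have hd0 : (0 : ℝ) < d := by exact_mod_cast (show 0 < d by omega)
  have hk : 0 < p * q := Nat.pos_of_ne_zero (NeZero.ne _)
  have hkR : (0 : ℝ) < (p * q : ℕ) := by exact_mod_cast hk
  -- the auxiliary field of discriminant `-pqd`
  haveI : NeZero (p * q * d) := ⟨mul_ne_zero (NeZero.ne _) (by omega)⟩
  have hsqd : Squarefree d := by
    rcases isFundamentalDiscriminant_discr (K := K) h2 with ⟨-, hsq, -⟩ | ⟨h4, -, -⟩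
    · exact Int.squarefree_natAbs.mpr hsq
    · exfalso; rw [Int.odd_iff] at hodd; omega
  have hcop : p.Coprime q := (Nat.coprime_primes Fact.out Fact.out).mpr hpq
  have hpd' : ¬ p ∣ d := fun h => hpd ((dvd_neg).mp (hdZ ▸ Int.natCast_dvd_natCast.mpr h))
  have hqd' : ¬ q ∣ d := fun h => hqd ((dvd_neg).mp (hdZ ▸ Int.natCast_dvd_natCast.mpr h))
  have hsqN : Squarefree (p * q * d) := by
    have hc : (p * q).Coprime d := Nat.Coprime.mul_left ((Nat.Prime.coprime_iff_not_dvd Fact.out).mpr hpd')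
      ((Nat.Prime.coprime_iff_not_dvd Fact.out).mpr hqd')
    exact Nat.squarefree_mul_iff.mpr ⟨hc, Nat.squarefree_mul_iff.mpr
      ⟨hcop, (Fact.out : p.Prime).squarefree, (Fact.out : q.Prime).squarefree⟩, hsqd⟩
  have hd3 : (d : ℤ) % 4 = 3 := by
    rcases Int.even_or_odd t with ⟨r, hr⟩ | ⟨r, hr⟩
    · exfalso; rw [hdisc, Int.odd_iff, hr] at hodd; ring_nf at hodd; omega
    · have : (d : ℤ) = -(4 * (r ^ 2 + r + m)) - 1 := by rw [hdZ, hr]; ring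
      omega
  have hN1 : (-((p * q * d : ℕ) : ℤ)) % 4 = 1 := by
    have hx : ((p * q : ℕ) : ℤ) % 4 = 1 := by exact_mod_cast hk4
    have hxd : ((p * q * d : ℕ) : ℤ) % 4 = 3 := by
      rw [Nat.cast_mul, Int.mul_emod, hx, hd3]; norm_num
    omega
  obtain ⟨h', h1, hle, hL'⟩ := exists_classNumber_LFunction_one_eq hN1 hsqN (by nlinarith [hd4, hk])
  have hdR' : -((t : ℝ) ^ 2 + 4 * (m : ℝ)) = (d : ℝ) := by
    have := congrArg (fun z : ℤ => (z : ℝ)) hdZ; push_cast at this; linarith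
  refine ⟨h', h1, ?_, ?_⟩
  · push_cast at hle ⊢
    rw [hdR']
    exact hle
  -- the limit formula and the Bessel bound
  have hDp : ((t ^ 2 + 4 * m : ℤ) : ZMod p) ≠ 0 := by rwa [Ne, ZMod.intCast_zmod_eq_zero_iff_dvd]
  have hDq : ((t ^ 2 + 4 * m : ℤ) : ZMod q) ≠ 0 := by rwa [Ne, ZMod.intCast_zmod_eq_zero_iff_dvd]
  have hLF := baker_limit_formula h2 hodd b hb hω hD hp2 hq2 hpq hDp hDq
  simp only at hLF
  have hD0 : t ^ 2 + 4 * m < 0 := by linarith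
  have hκ : starkK 1 (t : ℝ) (-m : ℝ) = Real.sqrt d / 2 := by
    rw [starkK_one]; push_cast; rw [hdR']
  have hη' : Real.exp (-(2 * Real.pi * starkK 1 (t : ℝ) (-m : ℝ) / (p * q : ℕ))) ≤ 1 / 2 := by
    rw [hκ]
    have e : -(2 * Real.pi * (Real.sqrt d / 2) / (p * q : ℕ)) =
        -(Real.pi * Real.sqrt (-(t ^ 2 + 4 * m : ℤ) : ℝ) / (p * q)) := by
      push_cast; rw [hdR']; ring
    rw [e]; exact hη
  have hB := norm_tsum_besselPart_one_le_of_le_half (isPosDefForm_one hD0) hk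
    (norm_weight_le (jacobiChar (p * q)) t m) hη'
  rw [hκ] at hB
  -- algebra: multiply the limit formula by `A = pq √d / π`
  set A : ℝ := (p * q : ℕ) * Real.sqrt d / Real.pi with hA
  have hπ0 : (0 : ℝ) < Real.pi := Real.pi_pos
  have hA0 : 0 < A := by rw [hA]; positivity
  have hsd : 0 < Real.sqrt d := Real.sqrt_pos.mpr hd0
  have hsk : 0 < Real.sqrt (p * q : ℕ) := Real.sqrt_pos.mpr hkR
  have hsqrt : Real.sqrt ((p * q * d : ℕ) : ℝ) = Real.sqrt (p * q : ℕ) * Real.sqrt d := by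
    rw [Nat.cast_mul, Real.sqrt_mul (by positivity)]
  have key : (h' : ℂ) * (Real.sqrt (p * q : ℕ) : ℂ) * (jacobiChar (p * q)).LFunction 1 =
      (jacobiChar (p * q)).LFunction 1 * (jacobiChar (p * q * d)).LFunction 1 * (A : ℂ) := by
    rw [hL', hA, hsqrt]
    have h1 : (Real.sqrt (p * q : ℕ) : ℂ) ≠ 0 := Complex.ofReal_ne_zero.mpr hsk.ne'
    have h2 : (Real.sqrt d : ℂ) ≠ 0 := Complex.ofReal_ne_zero.mpr hsd.ne'
    have h3 : (Real.pi : ℂ) ≠ 0 := Complex.ofReal_ne_zero.mpr hπ0.ne'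
    have hpq0 : (0 : ℝ) ≤ (p : ℝ) * q := by positivity
    have h4 : ((Real.sqrt ((p : ℝ) * q)) : ℂ) * (Real.sqrt ((p : ℝ) * q)) = (p : ℂ) * q := by
      rw [← Complex.ofReal_mul, Real.mul_self_sqrt hpq0]; push_cast; ring
    have h1' : ((Real.sqrt ((p : ℝ) * q)) : ℂ) ≠ 0 := by
      have : (Real.sqrt (p * q : ℕ) : ℂ) = ((Real.sqrt ((p : ℝ) * q)) : ℂ) := by push_cast; ring_nf
      rw [← this]; exact h1
    push_cast
    field_simp
    linear_combination ((h' : ℂ) * (jacobiChar (p * q)).LFunction 1) * h4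
  rw [key, hLF, LFunction_one_two_eq_ofReal hpq, add_mul]
  have hMA : (((1 - ((p : ℝ) ^ 2)⁻¹) * (1 - ((q : ℝ) ^ 2)⁻¹) * (Real.pi ^ 2 / 6) : ℝ) : ℂ) * (A : ℂ) =
      (((1 - ((p : ℝ) ^ 2)⁻¹) * (1 - ((q : ℝ) ^ 2)⁻¹) * ((p * q : ℕ) / 6) * Real.pi *
        Real.sqrt (-(t ^ 2 + 4 * m : ℤ) : ℝ) : ℝ) : ℂ) := by
    rw [← Complex.ofReal_mul]
    congr 1
    push_cast
    rw [hdR', hA]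
    push_cast
    field_simp
  rw [hMA, show ∀ x y : ℂ, x + y - x = y from fun x y => by ring, norm_mul, Complex.norm_real,
    Real.norm_eq_abs, abs_of_pos hA0]
  have e : -(2 * Real.pi * (Real.sqrt d / 2) / (p * q : ℕ)) =
      -(Real.pi * Real.sqrt (-(t ^ 2 + 4 * m : ℤ) : ℝ) / (p * q)) := by
    push_cast; rw [hdR']; ring
  rw [e] at hB
  calc ‖∑' y : ℕ, besselPart (fun r : ℤ × ℤ => jacobiChar (p * q)
          ((r.1 ^ 2 + t * r.1 * r.2 - m * r.2 ^ 2 : ℤ) : ZMod (p * q))) 1 (t : ℝ) (-m : ℝ) (p * q) 1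
          ((y + 1 : ℕ) : ℤ)‖ * A
      ≤ (8 * Real.pi * 1 / (1 * (Real.sqrt d / 2)) *
          Real.exp (-(Real.pi * Real.sqrt (-(t ^ 2 + 4 * m : ℤ) : ℝ) / (p * q)))) * A := by
        exact mul_le_mul_of_nonneg_right hB hA0.le
    _ = 16 * (p * q : ℕ) * Real.exp (-(Real.pi * Real.sqrt (-(t ^ 2 + 4 * m : ℤ) : ℝ) / (p * q))) := by
        rw [hA]; field_simp; ring

end OneModulus

end Literature.NumberTheory.QuadraticFields.BakerLimitFormula
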